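import Summits.CriticalPhenomena.PercolationContinuityZ3.Theorems.PercNearOneGluingNoHeavyQuantLightTwoBlobFlow
import Summits.CriticalPhenomena.PercolationContinuityZ3.Theorems.PercNearOneGluingNoHeavyQuantFlowUncross
import HarnessLib

/-!
# QUANT lane R8, T-DEC, binder (II) `ConvClosedTResidue`: the FLOW LEMMA of the six-cell light-slice law ("LS-CORE") — DEC(j) of
# `c₁δ_{p+l} + c₂δ_{p+l′} + c_Pδ_{p+h} + d₁δ_{m+l} + d₂δ_{m+l′} + d_Gδ_{m+h}` from eight explicit flows and four capacity inequalities

builds on p205010 (kernel theorem, internal audit signed; external expert review pending)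

Support file (`--supports stmt-CriticalPhenomena-4575`), QUANT lane seat prim-quant-census-1 (gen 22), rung R8 of
`run/shared/lean/prim/quant/LADDER.md`.  Memo `run/shared/lean/prim/quant/prim-quant-census-1/LSCORE-G22.md` (and CONV-RESIDUE-G21 §3–§5).
Theorems only, standard axioms, no sorries.

THE OBJECT.  In the top-datum architecture for the two-sided residue of `ConvClosedT` (census-1 g21, `…QuantConvTopDatum`:
`lconv_decAtT_of_window_pdecAtT`) the only piece that is not already kernel is the LIGHT SLICE of the partner atom `ν_B`
(lows `l < l′`, absorber `h`) by the light straddling credit pair `c_A = {p, m; γ}` of the decomposed atom: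
`L = (1−γ)·shift_p ν_B + γ·shift_m ν_B`, a law on the six cells `p+l, p+l′, p+h` (row `p`) and `m+l, m+l′, m+h` (row `m`, the last one a
giant).  This file is the bookkeeping half of its DEC proof: given masses `c₁, c₂, c_P, d₁, d₂, d_G` (sum `1`) on these cells in the
pattern "row p = L L M, row m = M M G" (`2(p+l′) < T ≤ 2(m+l)`, `T ≤ 2(p+h)`, `p + h ≤ j < m + h`, `m + l′ ≤ j`), eight flows — from each of the
two lows `p+l`, `p+l′` into the three mids `p+h`, `m+l′`, `m+l` (amounts `F₁P, F₁₂, F₁₁`, `F₂P, F₂₂, F₂₁`, each positive only on a compatible pair)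
and the remainders into the giant `m+h` — and the four capacity inequalities (mid loads at the `LawDec.usage` rates, giant load at `x/(1−x)`),
the law is `DECAtT x T j M` (`decAtT_of_flowAtT`).  The positions `p + h` and `m + l′` (or `m + l`) may coincide; the lemma adds their
hypotheses in that case.  The arithmetic half (which flows, and why the four inequalities hold on the whole parameter region — the LP-dual
"breakpoint" inequalities of the memo) is in the companion files `…QuantLSCoreMMGCells` / `…QuantLSCoreMMG`.

* `LawDec.lsLaw_decAtT_of_flow` — the statement above.

[this work]; flow normal form `…QuantLawDecFlows` / `…QuantLawDecFlowsDecomposition` (typer g22), template `swLawAt_decAtT_of_flow`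
(typer g24).  Nothing here is cited as a published result.  The gluing rows served [cite: KozmaNitzan2024, Conjecture 3 (p. 15)];
product measure [cite: Grimmett1999, §1.3 p. 10].
-/

noncomputable section

namespace Summit.CriticalPhenomena.PercolationContinuityZ3.Theorems

namespace Quant

open Finset

namespace LawDec

/-- **DEC OF THE SIX-CELL LIGHT-SLICE LAW FROM ITS FLOW.**  Floor `0 < x < 1`, target `T`, layer `j`, top `M`; positions `p < m`,
`l < l′ < h` with `2(p+l′) < T` (both row-`p` tails are lows), `T ≤ 2(m+l)`, `T ≤ 2(p+h)` (the other row-`m` cells and the head cell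
of row `p` are absorbers), `p + h ≤ j`, `m + l′ ≤ j` (mids) and `j < m + h ≤ M` (the giant).  Masses `c₁, c₂, c_P, d₁, d₂, d_G` with
sum `1` (nonnegativity is implied by the flow) at `p+l, p+l′, p+h, m+l, m+l′, m+h`.  Flows `F₁P, F₁₂, F₁₁ ≥ 0` from `p+l` into `p+h, m+l′, m+l` and `F₂P, F₂₂, F₂₁ ≥ 0` from `p+l′`,
each positive only when the pair is compatible (`T < lo + hi`), with `F₁P + F₁₂ + F₁₁ ≤ c₁`, `F₂P + F₂₂ + F₂₁ ≤ c₂` (the rests ride the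
giant).  If no mid is overloaded (`usage·F` sums `≤` its mass) and `x/(1−x)·(rests) ≤ d_G`, the law is `DECAtT x T j M`. [this work] -/
theorem lsLaw_decAtT_of_flow (x T c₁ c₂ cP d₁ d₂ dG F₁P F₁₂ F₁₁ F₂P F₂₂ F₂₁ : ℝ) (p m l l' h j M : ℕ)
    (hx0 : 0 < x) (hx1 : x < 1)
    (hsum : c₁ + c₂ + cP + d₁ + d₂ + dG = 1)
    (hpm : p < m) (hll : l < l') (hlh : l' < h)
    (hlow : 2 * ((p : ℝ) + l') < T) (hmid1 : T ≤ 2 * ((m : ℝ) + l)) (hmidP : T ≤ 2 * ((p : ℝ) + h))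
    (hPj : p + h ≤ j) (hm2j : m + l' ≤ j) (hGj : j < m + h) (hGM : m + h ≤ M)
    (hF1P : 0 ≤ F₁P) (hF12 : 0 ≤ F₁₂) (hF11 : 0 ≤ F₁₁) (hF2P : 0 ≤ F₂P) (hF22 : 0 ≤ F₂₂) (hF21 : 0 ≤ F₂₁)
    (hF1Pc : 0 < F₁P → T < ((p + l : ℕ) : ℝ) + ((p + h : ℕ) : ℝ)) (hF12c : 0 < F₁₂ → T < ((p + l : ℕ) : ℝ) + ((m + l' : ℕ) : ℝ))
    (hF11c : 0 < F₁₁ → T < ((p + l : ℕ) : ℝ) + ((m + l : ℕ) : ℝ))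
    (hF2Pc : 0 < F₂P → T < ((p + l' : ℕ) : ℝ) + ((p + h : ℕ) : ℝ)) (hF22c : 0 < F₂₂ → T < ((p + l' : ℕ) : ℝ) + ((m + l' : ℕ) : ℝ))
    (hF21c : 0 < F₂₁ → T < ((p + l' : ℕ) : ℝ) + ((m + l : ℕ) : ℝ))
    (hR1 : F₁P + F₁₂ + F₁₁ ≤ c₁) (hR2 : F₂P + F₂₂ + F₂₁ ≤ c₂)
    (hcapP : usage x T j (p + l) (p + h) * F₁P + usage x T j (p + l') (p + h) * F₂P ≤ cP)
    (hcap2 : usage x T j (p + l) (m + l') * F₁₂ + usage x T j (p + l') (m + l') * F₂₂ ≤ d₂)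
    (hcap1 : usage x T j (p + l) (m + l) * F₁₁ + usage x T j (p + l') (m + l) * F₂₁ ≤ d₁)
    (hcapG : x / (1 - x) * ((c₁ - F₁P - F₁₂ - F₁₁) + (c₂ - F₂P - F₂₂ - F₂₁)) ≤ dG) :
    DECAtT x T j M (fun q => c₁ * (if q = p + l then (1:ℝ) else 0) + c₂ * (if q = p + l' then (1:ℝ) else 0)
      + cP * (if q = p + h then (1:ℝ) else 0) + d₁ * (if q = m + l then (1:ℝ) else 0)
      + d₂ * (if q = m + l' then (1:ℝ) else 0) + dG * (if q = m + h then (1:ℝ) else 0)) := by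
  classical
  -- the leftovers riding the giant
  set R₁ : ℝ := c₁ - F₁P - F₁₂ - F₁₁ with hR₁
  set R₂ : ℝ := c₂ - F₂P - F₂₂ - F₂₁ with hR₂
  have hR10 : 0 ≤ R₁ := by rw [hR₁]; linarith
  have hR20 : 0 ≤ R₂ := by rw [hR₂]; linarith
  -- names of the positions
  set a₁ : ℕ := p + l with ha₁
  set a₂ : ℕ := p + l' with ha₂
  set bP : ℕ := p + h with hbP
  set b₁ : ℕ := m + l with hb₁
  set b₂ : ℕ := m + l' with hb₂
  set bG : ℕ := m + h with hbG
  -- order facts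
  have ha12 : a₁ < a₂ := by omega
  have hab : a₂ < b₁ := by
    have : 2 * ((p : ℝ) + l') < 2 * ((m : ℝ) + l) := lt_of_lt_of_le hlow hmid1
    have : (p : ℝ) + l' < (m : ℝ) + l := by linarith
    exact_mod_cast (by exact_mod_cast this : p + l' < m + l)
  have hb12 : b₁ < b₂ := by omega
  have hb2G : b₂ < bG := by omega
  have hbPG : bP < bG := by omega
  have ha1P : a₂ < bP := by omega
  -- casts of positions
  have ca₁ : ((a₁ : ℕ) : ℝ) = (p : ℝ) + l := by rw [ha₁]; push_cast; ring
  have ca₂ : ((a₂ : ℕ) : ℝ) = (p : ℝ) + l' := by rw [ha₂]; push_cast; ring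
  have cbP : ((bP : ℕ) : ℝ) = (p : ℝ) + h := by rw [hbP]; push_cast; ring
  have cb₁ : ((b₁ : ℕ) : ℝ) = (m : ℝ) + l := by rw [hb₁]; push_cast; ring
  -- the flow
  set f : ℕ → ℕ → ℝ := fun s q =>
    (if s = a₁ then (1:ℝ) else 0) * (F₁P * (if q = bP then (1:ℝ) else 0) + F₁₂ * (if q = b₂ then (1:ℝ) else 0)
        + F₁₁ * (if q = b₁ then (1:ℝ) else 0) + R₁ * (if q = bG then (1:ℝ) else 0))
    + (if s = a₂ then (1:ℝ) else 0) * (F₂P * (if q = bP then (1:ℝ) else 0) + F₂₂ * (if q = b₂ then (1:ℝ) else 0)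
        + F₂₁ * (if q = b₁ then (1:ℝ) else 0) + R₂ * (if q = bG then (1:ℝ) else 0)) with hf
  have ind_nn : ∀ (P : Prop) [Decidable P], (0:ℝ) ≤ (if P then (1:ℝ) else 0) := fun P _ => by split_ifs <;> norm_num
  -- the law vanishes above `M` and has mass `1`
  have hvan : ∀ q, M < q → c₁ * (if q = a₁ then (1:ℝ) else 0) + c₂ * (if q = a₂ then (1:ℝ) else 0)
      + cP * (if q = bP then (1:ℝ) else 0) + d₁ * (if q = b₁ then (1:ℝ) else 0)
      + d₂ * (if q = b₂ then (1:ℝ) else 0) + dG * (if q = bG then (1:ℝ) else 0) = 0 := by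
    intro q hq
    rw [if_neg (by omega : q ≠ a₁), if_neg (by omega : q ≠ a₂), if_neg (by omega : q ≠ bP), if_neg (by omega : q ≠ b₁),
      if_neg (by omega : q ≠ b₂), if_neg (by omega : q ≠ bG)]
    ring
  have hmass : ∑ q ∈ Finset.range (M + 1), (c₁ * (if q = a₁ then (1:ℝ) else 0) + c₂ * (if q = a₂ then (1:ℝ) else 0)
      + cP * (if q = bP then (1:ℝ) else 0) + d₁ * (if q = b₁ then (1:ℝ) else 0)
      + d₂ * (if q = b₂ then (1:ℝ) else 0) + dG * (if q = bG then (1:ℝ) else 0)) = 1 := by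
    simp only [Finset.sum_add_distrib]
    rw [BlobDec2.sum_range_const_indicator _ a₁ (by omega), BlobDec2.sum_range_const_indicator _ a₂ (by omega),
      BlobDec2.sum_range_const_indicator _ bP (by omega), BlobDec2.sum_range_const_indicator _ b₁ (by omega),
      BlobDec2.sum_range_const_indicator _ b₂ (by omega), BlobDec2.sum_range_const_indicator _ bG (by omega)]
    linarith
  refine decAtT_of_flowAtT x T j M _ hx0 hx1 hvan hmass ⟨f, ?_, ?_, ?_, ?_⟩
  · -- nonnegativity
    intro s q
    simp only [hf]
    have i1 := ind_nn (s = a₁); have i2 := ind_nn (s = a₂); have j1 := ind_nn (q = bP); have j2 := ind_nn (q = b₂)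
    have j3 := ind_nn (q = b₁); have j4 := ind_nn (q = bG)
    have t1 : 0 ≤ F₁P * (if q = bP then (1:ℝ) else 0) + F₁₂ * (if q = b₂ then (1:ℝ) else 0)
        + F₁₁ * (if q = b₁ then (1:ℝ) else 0) + R₁ * (if q = bG then (1:ℝ) else 0) := by positivity
    have t2 : 0 ≤ F₂P * (if q = bP then (1:ℝ) else 0) + F₂₂ * (if q = b₂ then (1:ℝ) else 0)
        + F₂₁ * (if q = b₁ then (1:ℝ) else 0) + R₂ * (if q = bG then (1:ℝ) else 0) := by positivity
    positivity
  · -- support: only lows ship, only into compatible absorbers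
    intro s q hpos
    simp only [hf] at hpos
    -- the shipping position is one of the two lows
    have hs : s = a₁ ∨ s = a₂ := by
      by_contra hne
      push Not at hne
      rw [if_neg hne.1, if_neg hne.2] at hpos
      simp at hpos
    have hslow : 2 * (s : ℝ) < T := by
      rcases hs with hs | hs
      · rw [hs, ca₁]
        have : (l : ℝ) ≤ l' := by exact_mod_cast hll.le
        linarith
      · rw [hs, ca₂]; exact hlow
    have hsj : s ≤ j := by rcases hs with hs | hs <;> omega
    -- the receiving position is one of the four absorbers
    have hq : q = bP ∨ q = b₂ ∨ q = b₁ ∨ q = bG := by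
      by_contra hne
      push Not at hne
      rw [if_neg hne.1, if_neg hne.2.1, if_neg hne.2.2.1, if_neg hne.2.2.2] at hpos
      simp at hpos
    have hqM' : q ≤ M := by rcases hq with hq | hq | hq | hq <;> omega
    refine ⟨hsj, hslow, hqM', ?_⟩
    by_cases hqG : q = bG
    · exact Or.inl (by omega)
    · refine Or.inr ?_
      by_contra hT
      -- every flow term into `q` vanishes, contradicting positivity
      have zP : ∀ (F : ℝ) (b : ℕ), 0 ≤ F → (0 < F → T < (s : ℝ) + (b : ℝ)) → F * (if q = b then (1:ℝ) else 0) = 0 := by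
        intro F b hF hFc
        by_cases hqb : q = b
        · have hz : ¬ 0 < F := fun hp => hT (by rw [hqb]; exact hFc hp)
          rw [le_antisymm (not_lt.1 hz) hF, zero_mul]
        · rw [if_neg hqb, mul_zero]
      have zG1 : R₁ * (if q = bG then (1:ℝ) else 0) = 0 := by rw [if_neg hqG, mul_zero]
      have zG2 : R₂ * (if q = bG then (1:ℝ) else 0) = 0 := by rw [if_neg hqG, mul_zero]
      rcases hs with hs1 | hs2
      · rw [if_pos hs1, if_neg (by omega : s ≠ a₂)] at hpos
        rw [zP F₁P bP hF1P (fun hp => by rw [hs1]; exact hF1Pc hp), zP F₁₂ b₂ hF12 (fun hp => by rw [hs1]; exact hF12c hp),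
          zP F₁₁ b₁ hF11 (fun hp => by rw [hs1]; exact hF11c hp), zG1] at hpos
        simp at hpos
      · rw [if_pos hs2, if_neg (by omega : s ≠ a₁)] at hpos
        rw [zP F₂P bP hF2P (fun hp => by rw [hs2]; exact hF2Pc hp), zP F₂₂ b₂ hF22 (fun hp => by rw [hs2]; exact hF22c hp),
          zP F₂₁ b₁ hF21 (fun hp => by rw [hs2]; exact hF21c hp), zG2] at hpos
        simp at hpos
  · -- every low is shipped exactly
    intro s hsj hslow
    have hI : ∀ k, k ≤ M → ∑ q ∈ Finset.range (M + 1), (if q = k then (1:ℝ) else 0) = 1 := by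
      intro k hk
      rw [Finset.sum_ite_eq' (Finset.range (M + 1)) k (fun _ => (1:ℝ)), if_pos (Finset.mem_range.2 (by omega))]
    have hsum : ∑ q ∈ Finset.range (M + 1), f s q =
        (if s = a₁ then (1:ℝ) else 0) * (F₁P + F₁₂ + F₁₁ + R₁) + (if s = a₂ then (1:ℝ) else 0) * (F₂P + F₂₂ + F₂₁ + R₂) := by
      simp only [hf, Finset.sum_add_distrib, ← Finset.mul_sum, hI bP (by omega), hI b₂ (by omega), hI b₁ (by omega),
        hI bG (by omega), mul_one]
    rw [hsum]
    -- `s` is not an absorber position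
    have hsP : s ≠ bP := by
      rintro rfl; rw [cbP] at hslow; linarith
    have hs1' : s ≠ b₁ := by
      rintro rfl; rw [cb₁] at hslow; linarith
    have hs2' : s ≠ b₂ := by
      rintro rfl
      have : ((b₂ : ℕ) : ℝ) = (m : ℝ) + l' := by rw [hb₂]; push_cast; ring
      rw [this] at hslow
      have : (l : ℝ) ≤ l' := by exact_mod_cast hll.le
      linarith
    have hsG : s ≠ bG := by omega
    dsimp only
    rw [if_neg hsP, if_neg hs1', if_neg hs2', if_neg hsG]
    by_cases hs1 : s = a₁
    · rw [if_pos hs1, if_neg (by omega : s ≠ a₂), hR₁]; ring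
    · rw [if_neg hs1]
      by_cases hs2 : s = a₂
      · rw [if_pos hs2, hR₂]; ring
      · rw [if_neg hs2]; ring
  · -- no absorber is overloaded
    intro q hqM hself
    have hqa1 : q ≠ a₁ := by
      rintro rfl
      rcases hself with h1 | h1
      · omega
      · rw [ca₁] at h1; have : (l : ℝ) ≤ l' := by exact_mod_cast hll.le
        linarith
    have hqa2 : q ≠ a₂ := by
      rintro rfl
      rcases hself with h1 | h1
      · omega
      · rw [ca₂] at h1; linarith
    have e : ∀ s, usage x T j s q * f s q
        = (if s = a₁ then (1:ℝ) else 0) * (usage x T j a₁ q * (F₁P * (if q = bP then (1:ℝ) else 0)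
            + F₁₂ * (if q = b₂ then (1:ℝ) else 0) + F₁₁ * (if q = b₁ then (1:ℝ) else 0) + R₁ * (if q = bG then (1:ℝ) else 0)))
          + (if s = a₂ then (1:ℝ) else 0) * (usage x T j a₂ q * (F₂P * (if q = bP then (1:ℝ) else 0)
            + F₂₂ * (if q = b₂ then (1:ℝ) else 0) + F₂₁ * (if q = b₁ then (1:ℝ) else 0) + R₂ * (if q = bG then (1:ℝ) else 0))) := by
      intro s
      simp only [hf]
      by_cases hs1 : s = a₁
      · rw [if_pos hs1, if_neg (by omega : s ≠ a₂), hs1]; ring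
      · rw [if_neg hs1]
        by_cases hs2 : s = a₂
        · rw [if_pos hs2, hs2]; ring
        · rw [if_neg hs2]; ring
    have hJ : ∀ (k : ℕ) (c : ℝ), k ≤ j → ∑ s ∈ Finset.range (j + 1), (if s = k then (1:ℝ) else 0) * c = c := by
      intro k c hk
      rw [← Finset.sum_mul, Finset.sum_ite_eq' (Finset.range (j + 1)) k (fun _ => (1:ℝ)),
        if_pos (Finset.mem_range.2 (by omega)), one_mul]
    have hsum : ∑ s ∈ Finset.range (j + 1), usage x T j s q * f s q
        = usage x T j a₁ q * (F₁P * (if q = bP then (1:ℝ) else 0)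
            + F₁₂ * (if q = b₂ then (1:ℝ) else 0) + F₁₁ * (if q = b₁ then (1:ℝ) else 0) + R₁ * (if q = bG then (1:ℝ) else 0))
          + usage x T j a₂ q * (F₂P * (if q = bP then (1:ℝ) else 0)
            + F₂₂ * (if q = b₂ then (1:ℝ) else 0) + F₂₁ * (if q = b₁ then (1:ℝ) else 0) + R₂ * (if q = bG then (1:ℝ) else 0)) := by
      rw [Finset.sum_congr rfl (fun s _ => e s), Finset.sum_add_distrib, hJ a₁ _ (by omega), hJ a₂ _ (by omega)]
    rw [hsum]
    dsimp only
    rw [if_neg hqa1, if_neg hqa2]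
    by_cases hqG : q = bG
    · -- the giant
      rw [if_pos hqG, if_neg (by omega : q ≠ bP), if_neg (by omega : q ≠ b₂), if_neg (by omega : q ≠ b₁)]
      simp only [mul_one, mul_zero, add_zero, zero_add]
      have hgq : j + 1 ≤ q := by omega
      rw [usage_giant_eq x T j a₁ q hgq, usage_giant_eq x T j a₂ q hgq]
      have : x / (1 - x) * R₁ + x / (1 - x) * R₂ ≤ dG := by rw [← mul_add]; exact hcapG
      linarith
    · rw [if_neg hqG]
      by_cases hqP : q = bP
      · -- the head cell of row `p`, possibly together with `m + l′` or `m + l`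
        rw [if_pos hqP]
        by_cases hq2 : q = b₂
        · rw [if_pos hq2, if_neg (by omega : q ≠ b₁)]
          simp only [mul_one, mul_zero, add_zero, zero_add]
          have hc2' : usage x T j a₁ q * F₁₂ + usage x T j a₂ q * F₂₂ ≤ d₂ := by rw [hq2]; exact hcap2
          have hcP' : usage x T j a₁ q * F₁P + usage x T j a₂ q * F₂P ≤ cP := by rw [hqP]; exact hcapP
          have e1 : usage x T j a₁ q * (F₁P + F₁₂) + usage x T j a₂ q * (F₂P + F₂₂)
              = (usage x T j a₁ q * F₁P + usage x T j a₂ q * F₂P) + (usage x T j a₁ q * F₁₂ + usage x T j a₂ q * F₂₂) := by ring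
          rw [e1]
          linarith
        · rw [if_neg hq2]
          by_cases hq1 : q = b₁
          · rw [if_pos hq1]
            simp only [mul_one, mul_zero, add_zero, zero_add]
            have hc1' : usage x T j a₁ q * F₁₁ + usage x T j a₂ q * F₂₁ ≤ d₁ := by rw [hq1]; exact hcap1
            have hcP' : usage x T j a₁ q * F₁P + usage x T j a₂ q * F₂P ≤ cP := by rw [hqP]; exact hcapP
            have e1 : usage x T j a₁ q * (F₁P + F₁₁) + usage x T j a₂ q * (F₂P + F₂₁)
                = (usage x T j a₁ q * F₁P + usage x T j a₂ q * F₂P) + (usage x T j a₁ q * F₁₁ + usage x T j a₂ q * F₂₁) := by ring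
            rw [e1]
            linarith
          · rw [if_neg hq1]
            simp only [mul_one, mul_zero, add_zero, zero_add]
            rw [hqP]; linarith [hcapP]
      · rw [if_neg hqP]
        by_cases hq2 : q = b₂
        · rw [if_pos hq2, if_neg (by omega : q ≠ b₁)]
          simp only [mul_one, mul_zero, add_zero, zero_add]
          rw [hq2]; linarith [hcap2]
        · rw [if_neg hq2]
          by_cases hq1 : q = b₁
          · rw [if_pos hq1]
            simp only [mul_one, mul_zero, add_zero, zero_add]
            rw [hq1]; linarith [hcap1]
          · rw [if_neg hq1]
            simp only [mul_zero, add_zero]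
            rfl

end LawDec

end Quant

end Summit.CriticalPhenomena.PercolationContinuityZ3.Theorems
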